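import Summits.KontsevichZagierPeriods.Zeta5Search.TwoTaleOmega.FormalBarnesT
import Literature.NumberTheory.Irrationality.Zudilin2014.SecondTalePolar

/-!
# Formal Barnes functionals VI — LINK of the alternating functional with Zudilin's second-tale forms
(cell `pub-zeta5`, fam-tele gen 4)

HONEST FRAMING: systematic search; no irrationality claim unless certified.

OUR infrastructure (Summit side), blueprint `families/tele/RECURRENCE.md §13.1 (L2, LINK-T)`.  In the lattice variable
`u = 2t` the second-tale rational function is `R̂(u/2) = Σ_k 4A_k/(u+2k)² + Σ_k 2B_k/(u+2k)` (tree
`Zudilin2014.RT_eq_polar`, p256237); its DATA is `dataRT a b : PF` (`dataRT_eval`).  At the second-tale node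
`M = 1 − â₀*` every pole lies on the `+` side (`2k − â₀* ≥ 0`), and unfolding the alternating functional of
`FormalBarnesT` gives LITERALLY the tree's forms:
  `formQT a b = −(signT b/4) · altE1 (1 − â₀*) (dataRT a b)`,  `formPT a b = (signT b/2) · altE0 0 (1 − â₀*) (dataRT a b)`
(`link_formQT`, `link_formPT`; the factors are `r̂ = −((−1)^{d̂}/2)·E` and `η₂ = ζ(2)/2`), and the `log 2`-coordinate is
`altE2 (dataRT a b) = −2 Σ_k B_k` (`altE2_dataRT`; it vanishes by the residue theorem, which is never needed since the
coordinate is shift-invariant).  No analysis, no named fact.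
-/

noncomputable section

open Polynomial Finset fwdDiff
open Literature.NumberTheory.Irrationality.Zudilin2014

namespace Summit.KontsevichZagierPeriods.Zeta5Search.FormalBarnes

/-- `A₁` is the tree's `harmAlt1` (definitionally). -/
theorem A1_eq_harmAlt1 (m : ℕ) : A1 m = harmAlt1 m := rfl

/-- `A₂` is the tree's `harmAlt2` (definitionally). -/
theorem A2_eq_harmAlt2 (m : ℕ) : A2 m = harmAlt2 m := rfl

/-- The simple-pole weight on the `+` side (`m ≥ 0`) is `A₁(m)`. -/
theorem chi10_of_nonneg {m : ℤ} (h : 0 ≤ m) : chi10 m = A1 m.toNat := by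
  obtain ⟨n, rfl⟩ := Int.eq_ofNat_of_zero_le h
  rfl

/-- The double-pole weight on the `+` side (`m ≥ 0`) is `A₂(m)`. -/
theorem chi20_of_nonneg {m : ℤ} (h : 0 ≤ m) : chi20 m = A2 m.toNat := by
  obtain ⟨n, rfl⟩ := Int.eq_ofNat_of_zero_le h
  rfl

/-- The `η₂`-weight on the `+` side (`m ≥ 0`) is `−1`. -/
theorem chi21_of_nonneg {m : ℤ} (h : 0 ≤ m) : chi21 m = -1 := by
  obtain ⟨n, rfl⟩ := Int.eq_ofNat_of_zero_le h
  rfl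

/-- Summing against finitely many `Finsupp.single`s placed at `f k`. -/
theorem sum_singles_at {S : Finset ℤ} {f : ℤ → ℤ} {c : ℤ → ℚ} {h : ℤ → ℚ → ℚ} (h0 : ∀ k, h k 0 = 0)
    (hadd : ∀ k x y, h k (x + y) = h k x + h k y) :
    (∑ k ∈ S, Finsupp.single (f k) (c k)).sum h = ∑ k ∈ S, h (f k) (c k) := by
  rw [← Finsupp.sum_finsetSum_index h0 hadd]
  exact Finset.sum_congr rfl fun k _ => Finsupp.sum_single_index (h0 (f k))

/-- The second-tale indices satisfy `â_mid ≤ â₃*` (so every pole of `R̂` lies right of the node). -/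
theorem aMid_le_aMax3 (a : Fin 4 → ℤ) : aMid a ≤ aMax3 a := by
  unfold aMid aMax3; omega

/-- `â₀* ≤ 2·â_mid` (immediate from the definition of `â₀*`). -/
theorem a0star_le_two_mul_aMid (a : Fin 4 → ℤ) : a0star a ≤ 2 * aMid a := by
  unfold a0star; exact min_le_right _ _

variable (a b : Fin 4 → ℤ)

/-- Second-tale partial-fraction DATA in the lattice variable `u = 2t`: no polynomial part, simple parts `2B_k` and
double parts `4A_k` at the even lattice points `K = 2k`. -/
def dataRT : PF :=
  ⟨0, ∑ k ∈ Ico (aMid a) (bMax b), Finsupp.single (2 * k) (2 * coefBT a b k),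
    ∑ k ∈ Ico (aMax3 a) (bMin b), Finsupp.single (2 * k) (4 * coefAT a b k)⟩

/-- The data evaluate to `R̂(u/2)` (away from the poles; `AdmissibleT` as in `RT_eq_polar`). -/
theorem dataRT_eval {a b : Fin 4 → ℤ} (hab : AdmissibleT a b) {u : ℚ} (hu : (denT a b).eval (u / 2) ≠ 0) :
    (dataRT a b).eval u = RT a b (u / 2) := by
  rw [RT_eq_polar hab hu]
  unfold PF.eval dataRT
  simp only [eval_zero, zero_add]
  rw [sum_singles_at (fun _ => by simp) (fun _ _ _ => by ring),
    sum_singles_at (fun _ => by simp) (fun _ _ _ => by ring), add_comm]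
  congr 1
  · refine Finset.sum_congr rfl fun k _ => ?_
    push_cast
    rw [show u / 2 + (k : ℚ) = (u + 2 * k) / 2 by ring, div_pow, div_div_eq_mul_div]
    ring
  · refine Finset.sum_congr rfl fun k _ => ?_
    push_cast
    rw [show u / 2 + (k : ℚ) = (u + 2 * k) / 2 by ring, div_div_eq_mul_div]
    ring

/-- `η₂`-coordinate of the LINK: every double pole sits on the `+` side of the second-tale node. -/
theorem altE1_dataRT : altE1 (1 - a0star a) (dataRT a b) = -4 * ∑ k ∈ Ico (aMax3 a) (bMin b), coefAT a b k := by
  unfold altE1 dataRT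
  simp only
  rw [sum_singles_at (fun _ => by simp) (fun _ _ _ => by ring), Finset.mul_sum]
  refine Finset.sum_congr rfl fun k hk => ?_
  have hk0 : 0 ≤ 2 * k - a0star a := by
    have := (mem_Ico.1 hk).1; have := aMid_le_aMax3 a; have := a0star_le_two_mul_aMid a; linarith
  rw [show 2 * k + (1 - a0star a) - 1 = 2 * k - a0star a by ring, chi21_of_nonneg hk0, sgnZ_two_mul]
  ring

/-- `1`-coordinate of the LINK. -/
theorem altE0_dataRT : altE0 0 (1 - a0star a) (dataRT a b)
    = 2 * ∑ k ∈ Ico (aMid a) (bMax b), coefBT a b k * harmAlt1 (2 * k - a0star a).toNat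
      + 4 * ∑ k ∈ Ico (aMax3 a) (bMin b), coefAT a b k * harmAlt2 (2 * k - a0star a).toNat := by
  unfold altE0 dataRT
  simp only
  have hP : ePoly 0 (1 - a0star a) 0 = 0 := by simp [ePoly]
  rw [hP, zero_add, sum_singles_at (fun _ => by simp) (fun _ _ _ => by ring),
    sum_singles_at (fun _ => by simp) (fun _ _ _ => by ring), Finset.mul_sum, Finset.mul_sum]
  congr 1
  · refine Finset.sum_congr rfl fun k hk => ?_
    have hk0 : 0 ≤ 2 * k - a0star a := by
      have := (mem_Ico.1 hk).1; have := a0star_le_two_mul_aMid a; linarith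
    rw [show 2 * k + (1 - a0star a) - 1 = 2 * k - a0star a by ring, chi10_of_nonneg hk0, sgnZ_two_mul,
      A1_eq_harmAlt1]
    ring
  · refine Finset.sum_congr rfl fun k hk => ?_
    have hk0 : 0 ≤ 2 * k - a0star a := by
      have := (mem_Ico.1 hk).1; have := aMid_le_aMax3 a; have := a0star_le_two_mul_aMid a; linarith
    rw [show 2 * k + (1 - a0star a) - 1 = 2 * k - a0star a by ring, chi20_of_nonneg hk0, sgnZ_two_mul,
      A2_eq_harmAlt2]
    ring

/-- **LINK-T, `ζ(2)`-part**: `q̂(â,b̂) = −(signT/4)·E¹_{1−â₀*}[data R̂]` by unfolding. -/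
theorem link_formQT : formQT a b = -(signT b / 4) * altE1 (1 - a0star a) (dataRT a b) := by
  rw [altE1_dataRT]; unfold formQT; ring

/-- **LINK-T, rational part**: `p̂(â,b̂) = (signT/2)·E⁰_{1−â₀*}[data R̂]` by unfolding. -/
theorem link_formPT : formPT a b = (signT b / 2) * altE0 0 (1 - a0star a) (dataRT a b) := by
  rw [altE0_dataRT]
  unfold formPT
  have e : ∑ k ∈ Ico (aMax3 a) (bMin b), 2 * coefAT a b k * harmAlt2 (2 * k - a0star a).toNat
      = 2 * ∑ k ∈ Ico (aMax3 a) (bMin b), coefAT a b k * harmAlt2 (2 * k - a0star a).toNat := by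
    rw [Finset.mul_sum]
    exact Finset.sum_congr rfl fun k _ => by rw [mul_assoc]
  rw [e]
  ring

/-- The `log 2`-coordinate of the second-tale data: `−2 Σ_k B_k` (shift-invariant; `= 0` by the residue theorem,
never needed). -/
theorem altE2_dataRT : altE2 (dataRT a b) = -2 * ∑ k ∈ Ico (aMid a) (bMax b), coefBT a b k := by
  unfold altE2 dataRT
  simp only
  rw [sum_singles_at (fun _ => by simp) (fun _ _ _ => by ring), Finset.mul_sum]
  refine Finset.sum_congr rfl fun k _ => ?_
  rw [sgnZ_two_mul]; ring

end Summit.KontsevichZagierPeriods.Zeta5Search.FormalBarnes
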